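import Literature.NumberTheory.EllipticCurves.Kato2004.AdditiveNoSplitCyclotomicTwistRankZeroShaUpperBoundFineSelmerAtTwoSharp
import HarnessLib

/-!
# Kato 2004 at `p = 2`, SHARP form, at a SEMISTABLE `2` — MULTIPLICATIVE (split or non-split) or GOOD reduction — for IRREDUCIBLE `E[2]`, granted Coates–Sujatha's statement (A) at `(E, 2)`: `ord₂ #Ш(E/ℚ)[2^∞] + v₂(Tam E) ≤ ord₂(L(E,1)/Ω_E)` (TWO named facts; a READING of Kato's proofs at `p = 2`; the semistable companion of the three ADDITIVE readings)

Topic `NumberTheory/EllipticCurves`, sub-directory `Kato2004` (namespace = path). TWO named facts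
(`def … : Prop`, D-0014), nothing else. They are the SEMISTABLE companions of the sharp ADDITIVE readings
`Kato2004.rankZero_padicValNat_sha_add_padicValNat_tamagawa_le_at_two_of_irreducible_of_fineSelmerDual_fg`
(file `Kato2004/AdditivePotGoodRankZeroShaUpperBoundFineSelmerAtTwoSharp.lean`; steps T1–T14 / T1′–T7′ are in that file
and its predecessor `Kato2004/AdditivePotGoodRankZeroShaUpperBoundFineSelmerAtTwo.lean`) and
`…_of_noSplitTwistNegOneNegTwo_of_irreducible_of_fineSelmerDual_fg` (file
`Kato2004/AdditiveNoSplitCyclotomicTwistRankZeroShaUpperBoundFineSelmerAtTwoSharp.lean`; steps T15–T16), whose texts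
are NOT repeated: the hypothesis «ADDITIVE reduction at `2`» of those readings is REPLACED by «MULTIPLICATIVE reduction
at `2`» (first fact) resp. «GOOD reduction at `2`» (second fact), everything else unchanged. WHY THIS IS POSSIBLE: in
the sixteen steps the reduction type of `E` at `2` is used at EXACTLY THREE places (the earlier files say so step by
step: «the other steps», T16 (d)) —

  (i)   T3: the local term `𝐇²_loc` of Kato's Thm. 12.5 (3) at the `e₊`-primes `𝔭₊(𝔮)` must vanish;
  (ii)  T8: Tate's measure `μ_ω(E(ℚ₂)) = c₂ · #Ẽ_ns(𝔽₂)/2` enters the local index `exp*_ω(H¹(ℚ₂,T)) = 2^{−a}ℤ₂` through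
        `2^{−a} = μ_ω(E(ℚ₂))/#E(ℚ₂)_tors`, where the ADDITIVE readings used `#Ẽ_ns(𝔽₂) = #𝔾_a(𝔽₂) = 2`;
  (iii) T9: Kato's Thm. 12.5 (1) gives `exp*_ω(z) = L_{(2)}(E,1)/Ω⁺_γ · u`, `u ∈ ℤ₂^×`, with the `{2}`-DEPLETED value
        `L_{(2)}(E,1) = L(E,1) · L_2(E,1)^{−1}` (Euler factor at `2` removed), where the ADDITIVE readings used
        `L_2(E,s) = 1` (`a₂ = 0`);

and at a SEMISTABLE `2`: (i) holds (M-T3 below: good ⇒ (12.5.1); non-split ⇒ `E(ℚ₂(ζ_{2^∞}))[2^∞]` finite, T15;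
split ⇒ the local term sits at the `σ_{−1} = −1` prime `ker(κ^{−1})`, T16 with `ψ = 1`), while (ii) and (iii) change by
the SAME factor and CANCEL (M-T8/M-T9 below: `L_2(E,1)^{−1} = #Ẽ_ns(𝔽₂)/2` for every Kodaira type — Tate 1975 §1 /
Silverman *AEC* VII, the identity behind «`∫_{E(ℚ_p)} |ω| = c_p · L_p(E,1)^{−1}`»). So the count T6–T10 / T6′–T7′ returns
the SAME total. Written by the prover seat `bsd-2adic-addL2x` GEN 14 (cell `bsd-2adic`, rung K4, crux
stmt-BirchSwinnertonDyer-19098 `AdditiveRankZeroAtTwo`): the director's lane-B road «semistable base change + Kato's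
divisibility OVER THAT FIELD + norm descent» read COMPONENTWISE on the 169 census classes whose twist by `−1` is split
multiplicative — over `K = ℚ(i) ⊂ ℚ(ζ_{2^∞})` (inside Kato's own tower) the pair (`E` additive, `E^{(−1)}` SPLIT
MULTIPLICATIVE) is ONE `Λ`-module `𝐇(T₂E) ⊕ 𝐇(T₂E) ⊗ χ_{−1}`, and the `E^{(−1)}`-component of the reading is the first
fact below; repair-census entry R-B75. By-product habitat: the MULTIPLICATIVE rank-`0` crux of the same route
(`MultUpperHalfAtTwo`, item 19922; mult-2 CENSUS: 1 673 of 1 969 rank-`0` classes have irreducible `E[2]`, among them the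
52 «small `2`-adic image» classes for which no Euler-system door existed — this reading needs irreducibility of `E[2]`
only, no `2`-adic surjectivity, no sign of `Δ`). Flags for the referee (reading audit wanted, lit-kato format):
`Kato-12.5(1)(3)-(12.5.1)-13.13-T3-T8-T9-at-two-multiplicative-irreducible-fineSelmer-fg-sharp` and
`Kato-12.5(1)(3)-(12.5.1)-T8-T9-at-two-good-irreducible-fineSelmer-fg-sharp`.

## Notation

As in the earlier files: `E/ℚ` non-CM with globally minimal model `W`, `E[2]` IRREDUCIBLE (so `E(F)[2] = 0` for every
field `F` into which the cubic or sextic `ℚ(E[2])` does not embed: `ℚ(i)`, `ℚ(ζ_{2^n})`, the layers `ℚ_m`), `L(E,1) ≠ 0`,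
`Ш(E/ℚ)` finite; `T = T₂E`, `V = T ⊗ ℚ`, `W = E[2^∞]` (when no confusion with the model); `G_∞ = Gal(ℚ(ζ_{2^∞})/ℚ) =
Δ × U`, `Λ = ℤ₂[[G_∞]]`, `Λ' = ℤ₂[[Gal(ℚ^cyc/ℚ)]] ≅ ℤ₂[[X]]`, `Λ_U = ℤ₂[[U]]`; `K_∞ = ℚ₂(ζ_{2^∞})`, `H = Gal(ℚ̄₂/K_∞)`;
`c₂ = [E(ℚ₂) : E₀(ℚ₂)]`, `Ẽ_ns(𝔽₂)` = the non-singular points of the reduction of the minimal model, `2^t = #E(ℚ₂)[2^∞]`,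
`a₂ = 2 + 1 − #Ẽ(𝔽₂)` (good) resp. `a₂ = +1 / −1` (split / non-split multiplicative), `L_2(E,s)^{−1} = 1 − a₂2^{−s} +
𝟙_{good}·2^{1−2s}` the Euler factor at `2`, `L_{(2)}(E,s) = L(E,s)·L_2(E,s)^{−1}` (Kato's `L_{{p}}`: the Dirichlet series
over `n` prime to `p`).

## M-T3 — the local term of Thm. 12.5 (3) at a SEMISTABLE `2` (Kato (12.5.1), 13.13; T15, T16 of the sibling file)

* **Good reduction.** Kato's (12.5.1) (p. 222, VERBATIM in the sibling files): «If `𝐇²_loc(V_{F_λ}(f))_𝔭 ≠ 0`, then …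
  `f` is not potentially of good reduction at `p`». Good ⇒ potentially good ⇒ the local term VANISHES at every
  height-one `𝔭` — exactly as in the potentially-good additive reading (T3 as first written).
* **Non-split multiplicative reduction.** Over `ℚ₂`, `E ≅ E_q ⊗ ψ` with `ψ` the UNRAMIFIED quadratic character of `ℚ₂`
  (Silverman *ATAEC* Thm. V.5.3, Ex. 5.11 (b): non-split iff `ℚ₂(√γ)/ℚ₂` is unramified quadratic, `γ = −c₄/c₆`), and
  `E[2^∞] ≅ E_q[2^∞] ⊗ ψ` (proof of Cor. V.5.4). Since `K_∞/ℚ₂` is TOTALLY RAMIFIED, the unramified quadratic extension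
  `ℚ₂(√γ) = ℚ₂(√5)` is not contained in `K_∞`, i.e. `ψ|_H ≠ 1`, and T15 (c) CASE `ψ|_H ≠ 1` applies word for word:
  `#E(K_∞)[2^∞] = #(E_q[2^∞] ⊗ ψ)^H ≤ 4` — FINITE; hence by T15 (a)(b) (Kato 13.13: the Pontryagin dual of `𝐇²_loc(T)`
  is `C ≅ E(K_∞)[2^∞]`) `𝐇²_loc(V) = 0` and the local term VANISHES at every height-one `𝔭`.
* **Split multiplicative reduction.** `E ≅ E_q` over `ℚ₂` (`ψ = 1`, *ATAEC* V.5.3 (b)), `C = E_q(K_∞)[2^∞] ⊇ μ_{2^∞}` is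
  infinite and the local term does NOT vanish. T16 (a)–(c) with `ψ = 1`: `V₂E|_{G_{ℚ₂}}` is the non-split extension
  `0 → κ → V₂E → 𝟙 → 0` (the Kummer class of `q`, `v(q) > 0`), so `V(f) = V₂E(−1)` has the unique rank-one quotient
  `U = κ^{−1}` («`r = −1`», `χ = 1` in (12.5.1)), `𝐇²_loc(V(f)) ≅ U(−1)` is supported at `ker(κ^{−2})` with length `1`
  (13.13, (12.5.1) VERBATIM, T16 (a)), hence — after the `Λ`-semilinear twist of T12–T13 — the local term for `V₂E` is
  supported at the single height-one prime **`𝔭' = ker(Λ → ℤ₂, σ ↦ κ(σ)^{−1})`**, `𝔭' ∌ 2`, length `1` (T16 (b)), and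
  `κ(σ_{−1})^{−1} = −1` gives `σ_{−1} + 1 ∈ 𝔭'`, `σ_{−1} − 1 ∉ 𝔭'` (as `2 ∉ 𝔭'`): `𝔭'` is a «`c = −1`» prime, so
  `𝔭' ≠ 𝔭₊(𝔮)` for EVERY height-one `𝔮 ∌ 2` of `Λ'` (T16 (c): T3 applies Thm. 12.5 (3) only at the `c = +1` primes
  `𝔭₊(𝔮)` of the `e₊`-localisation `(𝐇'^q)_𝔮 ≅ (𝐇^q)_{𝔭₊(𝔮)}`) — the local term VANISHES AT EVERY PRIME THAT T3 USES.
  [This is T16's argument for the additive curves with `E^{(2)}` split multiplicative (`ψ = χ₂`, `χ₂(σ_{−1}) = +1`) with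
  `χ₂` replaced by the trivial character; no finiteness of `E_q(ℚ₂^cyc)[2^∞]` is used or claimed.]
* **14.13 at the augmentation prime (used in T3/T6 for `g(0)φ(0) ≠ 0`).** Kato's 14.13 needs `exp*` of the bottom
  class to be non-zero, i.e. `L_{(2)}(E,1) ≠ 0`: at a split `2`, `L_{(2)}(E,1) = (1 − 2^{−1})·L(E,1) = L(E,1)/2 ≠ 0`; at
  a non-split `2`, `= (3/2)·L(E,1) ≠ 0`; at a good `2`, `= #Ẽ(𝔽₂)/2 · L(E,1) ≠ 0` — the COMPLEX depleted value never
  vanishes (the exceptional zero of the `2`-adic `L`-function of Mazur–Tate–Teitelbaum at a split `2`, factor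
  `(1 − α^{−1}) = 0`, concerns the `p`-adic interpolation (Kato §16), which these readings never use); and the
  augmentation prime `ker(σ ↦ 1)` is not of the form `ker(κ^{−1}χ)`, `χ` of finite order, so it never carries the local
  term either (as already noted in the sibling file, «the other steps», for 14.13).

## M-T8 — the local index at a SEMISTABLE `2` (T8 of the first file with Tate's measure for the semistable types)

T8 (i)(ii) (`exp*`/`log` duality, `H¹_f(ℚ₂,T)` = the Kummer image of `E(ℚ₂) ⊗ ℤ₂ ≅ ℤ₂ × E(ℚ₂)[2^∞]`, Bloch–Kato Ex. 3.11,
`exp*_ω(H¹(ℚ₂,T)) = 2^{−a}ℤ₂` with `2^aℤ₂ = log_ω(E(ℚ₂))`) are stated for any `E/ℚ₂`. T8 (iii), with `U = Ê(4ℤ₂)`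
(`log_ω : U ≅ 4ℤ₂` measure-preservingly for ANY minimal model, Silverman *AEC* IV.6.4 with `r = 2 > v(2)/(2 − 1)`;
`μ_ω(U) = 1/4`) and `[E(ℚ₂) : U] = [E(ℚ₂) : E₀]·[E₀ : E₁]·[E₁ : U] = c₂ · #Ẽ_ns(𝔽₂) · 2` (`E₁/E₂ ≅ 𝔽₂`), reads
`μ_ω(E(ℚ₂)) = c₂ · #Ẽ_ns(𝔽₂)/2` (Tate 1975 §1, any Kodaira type) `= #E(ℚ₂)_tors · 2^{−a}`, i.e.
**`2^{−a} = c₂ · #Ẽ_ns(𝔽₂)/(2 · #E(ℚ₂)_tors)`**, **`a = t + 1 − v₂(c₂) − v₂(#Ẽ_ns(𝔽₂))`** (the odd parts cancel as in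
T8: `E₁(ℚ₂) = Ê(2ℤ₂)` is pro-`2`, so the prime-to-`2` torsion of `E(ℚ₂)` embeds in `E(ℚ₂)/E₁(ℚ₂)`, of order
`c₂·#Ẽ_ns(𝔽₂)`). Values: ADDITIVE `#Ẽ_ns(𝔽₂) = 2`, `a = t − v₂(c₂)` (the earlier T8); SPLIT multiplicative
`Ẽ_ns = 𝔾_m`, `#Ẽ_ns(𝔽₂) = 1`, `a = t + 1 − v₂(c₂)` (`c₂ = ord₂ Δ`); NON-SPLIT `Ẽ_ns` = the norm-one torus,
`#Ẽ_ns(𝔽₂) = 3`, `a = t + 1 − v₂(c₂)` (`c₂ ∈ {1, 2}`); GOOD `#Ẽ_ns(𝔽₂) = #Ẽ(𝔽₂) = 3 − a₂ ∈ {1, …, 5}`, `c₂ = 1`,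
`a = t + 1 − v₂(#Ẽ(𝔽₂))`.

## M-T9 — the value at a SEMISTABLE `2` (Thm. 12.5 (1) verbatim + the period computation of T9)

Thm. 12.5 (1) (p. 221, every `f`, every `p`): the image of `z_γ` under `exp*` and `per_f` at level `n = 0`, trivial
character, `r = 1`, is `L_{{p}}(f, 1)·γ^± /(2πi)^{0}`-normalised, i.e. (T9, `γ = γ⁺`, `Ω⁺_γ = Ω_E/2` for EITHER sign
of `Δ_E` — an archimedean computation, reduction-free): `exp*_ω(z) = L_{(2)}(E,1)/Ω⁺_γ · u = 2 · L_2(E,1)^{−1} ·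
L(E,1)/Ω_E · u`, `u ∈ ℤ₂^×`. Hence **`e := ord₂ exp*_ω(z) = 1 + ord₂(L(E,1)/Ω_E) + v₂(L_2(E,1)^{−1})`** with
`L_2(E,1)^{−1} = 1 − a₂/2 = 1/2` (split), `3/2` (non-split), `1 − a₂/2 + 1/2 = #Ẽ(𝔽₂)/2` (good), `1` (additive: the
earlier T9).

## The cancellation and the count

In every case **`L_2(E,1)^{−1} = #Ẽ_ns(𝔽₂)/2`** (good: `(2 − a₂ + 1)/2`; split: `(2 − 1)/2`; non-split: `(2 + 1)/2`;
additive: `2/2`), so `v₂(L_2(E,1)^{−1}) = v₂(#Ẽ_ns(𝔽₂)) − 1` and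
`e + a − t = [1 + ord₂(L/Ω_E) + v₂(#Ẽ_ns(𝔽₂)) − 1] + [t + 1 − v₂(c₂) − v₂(#Ẽ_ns(𝔽₂))] − t = ord₂(L(E,1)/Ω_E) + 1 − v₂(c₂)`
— INDEPENDENT OF THE REDUCTION TYPE, and equal to the value the additive readings carry into T7/T7′. The count is
therefore UNCHANGED: T6/T6′ (`#H²(ℤ[1/2],T) ≤ 2^{μ₂ − m}[H¹(ℤ[1/2],T) : z]`, `μ₂ = r_∞` under (A) by T4/T4′, `m ≥ 1` by
T11–T14), T7/T7′ (`#S₁(W) ≤ 2^{a + e − t − m}`), T10 (`S₁(W) ⊇ Ш(E/ℚ)[2^∞]` of index `∏_{ℓ odd} |c_ℓ|₂^{−1}`; the local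
condition at `2` is `H¹_f` on both sides, whatever the reduction) give `#S₁(W) ≤ 2^{ord₂(L(E,1)/Ω_E) − v₂(c₂)}` and the
TOTAL `ord₂ #Ш(E/ℚ)[2^∞] + Σ_ℓ v₂(c_ℓ) ≤ ord₂(L(E,1)/Ω_E)` for either sign of `Δ_E` — the two statements typed below.

## The other steps (why nothing else sees the reduction type at `2`; cf. «the other steps» and T16 (d) of the sibling)

T1/T1′ (archimedean): sign of `Δ_E` only. T2/T11 (torsion-freeness and freeness of `𝐇'¹` over `Λ'`, of `𝐇¹` over
`Λ_U`; 13.8): (12.2.1), Thm. 12.4 (2) are printed for every `f`; the regular-sequence step uses only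
`H⁰(ℚ, E[2]) = H⁰(ℚ(i), E[2]) = 0`. T3 apart from the local term: Thm. 12.4 (1), Thm. 12.5 (2)(3) via Thm. 13.4 (2) /
Kato 1999 Thm. 0.8, and 14.13 (M-T3, last item). T4/T4′ (statement (A) ⟺ `μ(𝐇'²) = r_∞`, Lim's lemma): the `2`-adic
local term `⊕_{w∣2} H⁰(ℚ^cyc_w, E[2^∞])^∨` of the limit Poitou–Tate sequence is `ℤ₂`-finitely generated for EVERY `E` (a
subquotient of `T₂E^∨`, `ℤ₂`-rank `≤ 2`) — at a split `2` it is NOT finite-dual (`μ_{2^∞}(ℚ₂^cyc) = {±1}`, but a Kummer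
part may survive), which affects neither `μ(𝐇'²) = r_∞` under (A) nor T3 (exactly T16 (d)). T5/T12 (integrality, Thm.
12.6 + 13.14, Remark 12.8): every `f`, irreducible `E[2]`. T6/T6′ (14.14 + Lemma 14.15): `𝐇'³[X] = 0` (T1/T1′) and
`H⁰(ℤ[1/2], T) = 0`. T7/T7′ (Prop. 14.16 (2) / the Poitou–Tate count with the real place): formal in the local
conditions; `H¹_F(ℚ,T) = 0` in rank `0` with `Ш[2^∞]` finite and `E(ℚ)[2] = 0`. T10: `ℓ ≠ 2` only. T13–T14 (complex
conjugation, descent of `c`-invariant classes): Thm. 12.5 (1)'s last clause and `E(ℚ(ζ_{2^{m+2}}))[2] = 0`. NON-CM: a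
curve with multiplicative reduction is never CM (CM ⇒ potentially good everywhere); the hypothesis `¬ W.HasCM` is kept
in both facts for uniformity with the additive readings and the route's binders (Kato's §13 = the non-CM case).

CONSISTENCY CHECK (not used). With `E(ℚ)[2] = 0` the Birch–Swinnerton-Dyer formula predicts
`ord₂ #Ш + Σ_ℓ v₂(c_ℓ) = ord₂(L(E,1)/Ω_E)` EXACTLY, semistable `2` included (`c₂ = ord₂ Δ` at a split `2` counted in
`Σ_ℓ`): the reading is the full «Euler-system half» of BSD₂ on this class, with no spare factor — as for the additive
(NST′) curves. The cell's mult census (PROOF-KATO2MULT S0-3, kit j248824) observed the same cancellation numerically on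
808/808 non-split surjective `Δ < 0` classes («the two factors `2 = (1 − a₂^{−1}) = l_v` cancelling»).

WHAT IS NOT CLAIMED. Statement (A) is NOT asserted (hypothesis; a theorem when `ℚ(E[2])` is abelian, by Lim 2017 Thm.
3.5 at `2` + Ferrero–Washington — recorded Summits-side); nothing for reducible `E[2]` (rational `2`-torsion: T2, T5,
T11, T12, T14 use `H⁰(·, E[2]) = 0`; Greenberg's `μ > 0` examples at `2` all live there), for CM curves, in analytic rank
`1`, or about the `2`-adic `L`-function / the cyclotomic main conjecture at `2` (no `p`-adic `L`-function, no Coleman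
map, no 𝓛-invariant is used: this is the rank-`0` `L`-VALUE bound, not a characteristic-ideal divisibility); no lower
bound; the finiteness of `E_q(ℚ₂^cyc)[2^∞]` is neither used nor claimed. The non-verbatim steps are M-T3 (the three case
distinctions, each a line of T15/T16), M-T8, M-T9 and the cancellation above, plus those listed in the three earlier
files; the verbatim inputs are Kato's (12.2.1), Thm. 12.4 (1)(2), Thm. 12.5 (1)(2)(3), (12.5.1), Thm. 12.6, Remarks
12.7–12.8, 13.8, 13.9, 13.13–13.14, 14.13–14.16. Never stronger than what these arguments give; no `_holds` (size XL).
Derivation memo: `run/shared/lean/pub/bsd-2adic/addL2x/VERDICT-19098-addL2x-GEN14.md`.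

THE LEAN STATEMENTS. Exactly the SHARP additive fact of `Kato2004/AdditivePotGoodRankZeroShaUpperBoundFineSelmerAtTwoSharp.lean`
with its two reduction hypotheses `¬ W.HasGoodReductionAtPrime 2 → ¬ W.HasMultiplicativeReductionAtPrime 2 →
0 ≤ padicValRat 2 W.j →` REPLACED by `W.HasMultiplicativeReductionAtPrime 2 →` (first fact) resp.
`W.HasGoodReductionAtPrime 2 →` (second fact); same (A)-binder (`∃ γ D` over `WeierstrassCurve.FineSelmerDualData`),
same conclusion (`q = L(E,1)/Ω(W)`, `ord₂ #Ш(E)(2) + v₂(Tam W) ≤ ord₂ q`).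

## References

* K. Kato, Astérisque 295 (2004): (12.2.1) (p. 220), Thm. 12.4 (1)(2) (p. 221), **Thm. 12.5 (1)** (p. 221: `exp*`,
  `per_f`, the depleted value `L_{{p}}(f, χ, r)`, and the last clause `z_{ι(γ)} = −σ_{−1}(z_γ)`), Thm. 12.5 (2)(3) and
  **(12.5.1)** (p. 222), Thm. 12.6, Remarks 12.7–12.8 (pp. 222–223), 13.8 (pp. 227–229), 13.9 (pp. 229–230), **13.13**
  (pp. 233–234: the Pontryagin dual `C` of the local term; `U` with `r = −1`; `𝐇²_loc(V) ≅ U(−1)`), 13.14 (p. 234),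
  14.13 (p. 242), 14.14 and Lemma 14.15 (pp. 243–244), Prop. 14.16 (2) (pp. 244–245), §16.1 (the root `α`, not used).
  [Kato2004Asterisque]
* K. Kato, Kodai Math. J. 22 (1999) 313–372, Thm. 0.8. [Kato1999Kodai]
* J. H. Silverman, *Advanced Topics in the Arithmetic of Elliptic Curves*, GTM 151 (1994): V.3 (Tate curve), Lemma
  V.5.2, Thm. V.5.3, proof of Cor. V.5.4, Exercise 5.11 (a)(b)(c); IV.9 Table 4.1 (`Ẽ_ns`: `𝔾_m`, the norm-one torus,
  `𝔾_a`). [SilvermanATAEC1994]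
* J. H. Silverman, *AEC* (2nd ed.), IV.6.4 (formal logarithm), VII.2.1 / VII.6.1 (`E₀/E₁ ≅ Ẽ_ns(𝔽_p)`, finiteness of
  `E/E₀`), III.8, Thm. X.4.14. [SilvermanAEC2009]
* J. Tate, «Algorithm for determining the type of a singular fiber in an elliptic pencil», LNM 476 (1975) §1 (the
  measure `∫_{E(ℚ_p)}|ω| = c_p · #Ẽ_ns(𝔽_p)/p = c_p/L_p(E,1)`). [Tate1975]
* B. Mazur, J. Tate, J. Teitelbaum, Invent. Math. 84 (1986), §I.14 (the exceptional zero is a `p`-adic phenomenon;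
  context only). [MazurTateTeitelbaum1986Invent]
* J. Coates, R. Sujatha, Math. Ann. 331 (2005) 809–839, statement (A). [CoatesSujatha2005]
* M. F. Lim, Asian J. Math. 21 (2017) 337–362, §3. [Lim2017FineSelmer]
* S. Bloch, K. Kato, *The Grothendieck Festschrift* I (1990), §3 Def. 3.10, Ex. 3.11, Prop. 3.8. [BlochKato1990]
* W. Bruns, J. Herzog, *Cohen–Macaulay rings*, Thm. 1.3.3, Prop. 1.4.1. [BrunsHerzog1998]
* J. Neukirch, A. Schmidt, K. Wingberg, *Cohomology of Number Fields*, (1.6.7), (1.5.6)–(1.5.7). [NeukirchSchmidtWingberg2008]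
* K. Rubin, *Euler Systems*, Ch. I §3 and Thm. I.7.3; Ch. III §5. [Rubin2000]
* R. Greenberg, LNM 1716 (1999), Prop. 4.13. [GreenbergLNM1716]
-/

noncomputable section

open scoped Classical

namespace Literature.NumberTheory.EllipticCurves.Kato2004

open WeierstrassCurve

/-- **Kato's Euler-system bound at a MULTIPLICATIVE `2` (split or non-split), in analytic rank `0`, for IRREDUCIBLE
`E[2]` and either sign of the discriminant, GRANTED Coates–Sujatha's statement (A) at `(E, 2)` — SHARP form:
`ord₂ #Ш(E/ℚ)[2^∞] + v₂(∏_ℓ c_ℓ) ≤ ord₂(L(E,1)/Ω_E)`.** The SHARP additive readings (T1–T16 of the sibling files: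
**(12.2.1)**, **Thm. 12.4 (2)**, **13.8** over `Λ'` and `Λ_U`, **Thm. 12.6** + **13.14** + Remark 12.8 (integrality from
irreducibility), **Thm. 12.5 (1)** incl. `z_{ι(γ)} = −σ_{−1}(z_γ)` (**13.9**; `z' = 2y'`), **Thm. 12.5 (3)** at `2` via Kato
1999 Thm. 0.8 at the `e₊`-primes, the `μ`-part from the HYPOTHESIS (A) via Lim's lemma, **14.13**, **14.14 + Lemma
14.15**, **Prop. 14.16 (2)** / the Poitou–Tate count with the real place) with the word ADDITIVE replaced by
MULTIPLICATIVE at the three places where the reduction at `2` enters: (M-T3) the local term of Thm. 12.5 (3) — at a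
NON-split `2`, `E ≅ E_q ⊗ ψ` with `ψ` unramified quadratic (Silverman *ATAEC* **Thm. V.5.3**, Ex. 5.11), `ψ` is
non-trivial on `Gal(ℚ̄₂/ℚ₂(ζ_{2^∞}))` (totally ramified tower), so `E(ℚ₂(ζ_{2^∞}))[2^∞]` is finite (`≤ 4`) and by
**13.13** the term is `0` (T15); at a SPLIT `2`, `E ≅ E_q`, the term is non-zero but by **(12.5.1)** + **13.13**
(`V(f) ↠ U = κ^{−1}`, length `1`) it is supported at the single prime `𝔭' = ker(κ^{−1})` of `Λ`, a «`σ_{−1} = −1`» prime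
(`κ(σ_{−1}) = −1`), never among the «`c = +1`» primes `𝔭₊(𝔮)` at which step T3 applies Thm. 12.5 (3) (T16 with `ψ = 1`);
(M-T8) Tate's measure `μ_ω(E(ℚ₂)) = c₂·#Ẽ_ns(𝔽₂)/2` with `#Ẽ_ns(𝔽₂) = 1` (split) / `3` (non-split) in the local index
`2^{−a} = μ_ω(E(ℚ₂))/#E(ℚ₂)_tors`; (M-T9) Kato's depleted value `L_{(2)}(E,1) = (1 − a₂/2)·L(E,1)`, `a₂ = ±1`, in
`exp*_ω(z) = L_{(2)}(E,1)/Ω⁺_γ·u`, `Ω⁺_γ = Ω_E/2`; and `1 − a₂/2 = #Ẽ_ns(𝔽₂)/2` makes (M-T8) and (M-T9) CANCEL, so the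
count T6–T10 / T6′–T7′ is unchanged (module docstring: M-T3, M-T8, M-T9, «the cancellation and the count», «the other
steps», what is not claimed). Let `W/ℚ` be a globally minimal NON-CM elliptic curve with MULTIPLICATIVE reduction at `2`,
`E[2]` irreducible, `L(E,1) ≠ 0`, `Ш(E/ℚ)` finite, and assume (`hA`) that for every cyclotomic `ℤ₂`-extension datum `κ`
of `ℚ` some Pontryagin-dual datum `D` of `Sel₀(ℚ^cyc, E[2^∞])` has `ℤ₂`-finitely generated underlying module. Then there
is `q ∈ ℚ` with `L(E,1)/Ω(W) = q` and `ord₂ #Ш(E/ℚ)(2) + v₂(Tam(W)) ≤ ord₂ q`. A READING (non-verbatim steps M-T3,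
M-T8, M-T9 and those of the three additive files, written out in the module docstrings); never stronger than what the
arguments give; nothing about the `2`-adic `L`-function, characteristic ideals or the exceptional zero; no `_holds`
(size XL). Flag for the referee: `Kato-12.5(1)(3)-(12.5.1)-13.13-T3-T8-T9-at-two-multiplicative-irreducible-fineSelmer-fg-sharp`.
[cite: Kato2004Asterisque, (12.2.1) (p. 220), Thm. 12.4 (1)(2) (p. 221), Thm. 12.5 (1) incl. the depleted value L_{p} and its last clause (p. 221), Thm. 12.5 (3) and (12.5.1) incl. the description of 𝔭 and length 1 (p. 222), Thm. 12.6 and Remarks 12.7–12.8 (pp. 222–223), 13.8 (pp. 227–229), 13.9 (pp. 229–230), 13.13 (pp. 233–234: C, U with r = −1, 𝐇²_loc(V) ≅ U(−1)), 13.14 (p. 234), 14.13 (p. 242), 14.14 and Lemma 14.15 (pp. 243–244), Prop. 14.16 (2) (pp. 244–245)]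
[cite: Kato1999Kodai, Thm. 0.8 (p. 318)]
[cite: SilvermanATAEC1994, V.3; Lemma V.5.2; Thm. V.5.3; proof of Cor. V.5.4 (p. 442); Exercise 5.11 (a)(b)(c); IV.9 Table 4.1]
[cite: SilvermanAEC2009, IV.6.4, VII.2.1, VII.6.1, III.8, Thm. X.4.14]
[cite: Tate1975, §1 (the measure c_p·#Ẽ_ns(𝔽_p)/p)]
[cite: BrunsHerzog1998, Thm. 1.3.3, Prop. 1.4.1]
[cite: NeukirchSchmidtWingberg2008, (1.6.7), (1.5.6)–(1.5.7)]
[cite: Rubin2000, Ch. I §3 and Thm. I.7.3; Ch. III §5]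
[cite: Lim2017FineSelmer, §3] [cite: CoatesSujatha2005, statement (A) (introduction and §3)]
[cite: BlochKato1990, §3 Def. 3.10, Ex. 3.11, Prop. 3.8]
[cite: GreenbergLNM1716, Prop. 4.13] -/
def rankZero_padicValNat_sha_add_padicValNat_tamagawa_le_at_two_of_multiplicative_of_irreducible_of_fineSelmerDual_fg :
    Prop :=
  ∀ (W : WeierstrassCurve ℚ) [W.IsElliptic] [W.IsGloballyMinimal], ¬ W.HasCM →
    W.HasMultiplicativeReductionAtPrime 2 →
    W.HasIrreducibleModPGaloisRep 2 →
    (∀ (κ : ZpExtension ℚ 2), κ.IsCyclotomic →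
      ∃ (γ : Field.absoluteGaloisGroup ℚ) (D : W.FineSelmerDualData κ γ),
        Module.Finite ℤ_[2] (RestrictScalars ℤ_[2] (IwasawaAlgebra 2) D.X)) →
    W.entireLFunction 1 ≠ 0 → Finite W.sha →
    ∃ q : ℚ, W.entireLFunction 1 / (W.realPeriodRat : ℂ) = (q : ℂ) ∧
      (padicValNat 2 (Nat.card (AddCommGroup.primaryComponent W.sha 2)) : ℤ) +
          padicValNat 2 W.tamagawaProduct ≤ padicValRat 2 q

/-- **Kato's Euler-system bound at a GOOD `2` (ordinary or supersingular), in analytic rank `0`, for IRREDUCIBLE `E[2]`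
and either sign of the discriminant, GRANTED Coates–Sujatha's statement (A) at `(E, 2)` — SHARP form:
`ord₂ #Ш(E/ℚ)[2^∞] + v₂(∏_ℓ c_ℓ) ≤ ord₂(L(E,1)/Ω_E)`.** The same reading at a GOOD `2`: (M-T3) the local term of
**Thm. 12.5 (3)** vanishes by Kato's **(12.5.1)** as printed («`f` is not potentially of good reduction at `p`» is
necessary for a non-zero local term) — the original T3; (M-T8) Tate's measure `μ_ω(E(ℚ₂)) = #Ẽ(𝔽₂)/2` (`c₂ = 1`) in the
local index; (M-T9) Kato's depleted value `L_{(2)}(E,1) = (1 − a₂/2 + 1/2)·L(E,1) = #Ẽ(𝔽₂)/2 · L(E,1)` (**Thm. 12.5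
(1)**), `Ω⁺_γ = Ω_E/2`; the two factors `#Ẽ(𝔽₂)/2` CANCEL and the count T6–T10 / T6′–T7′ is unchanged. Filed for
UNIFORMITY (the rank-`0` `L`-VALUE bound of Kato's Euler system at `2` under (A) and irreducible `E[2]` does not see the
reduction type at a semistable `2`); it says nothing about the `2`-adic `L`-function, `λ/μ`-invariants or characteristic
ideals at an ordinary `2`, and nothing for reducible `E[2]` (the habitat of Greenberg's Prop. 5.13/5.14). Let `W/ℚ`
be a globally minimal NON-CM elliptic curve with GOOD reduction at `2`, `E[2]` irreducible, `L(E,1) ≠ 0`, `Ш(E/ℚ)`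
finite, and assume (`hA`) statement (A) at `(E,2)` in the `∃ γ D` spelling. Then there is `q ∈ ℚ` with
`L(E,1)/Ω(W) = q` and `ord₂ #Ш(E/ℚ)(2) + v₂(Tam(W)) ≤ ord₂ q`. A READING (non-verbatim steps M-T8, M-T9 and those of
the three additive files); never stronger than what the arguments give; no `_holds` (size XL). Flag for the referee:
`Kato-12.5(1)(3)-(12.5.1)-T8-T9-at-two-good-irreducible-fineSelmer-fg-sharp`.
[cite: Kato2004Asterisque, (12.2.1) (p. 220), Thm. 12.4 (1)(2) (p. 221), Thm. 12.5 (1) incl. the depleted value L_{p} (p. 221), Thm. 12.5 (3) and (12.5.1) (p. 222), Thm. 12.6 and Remarks 12.7–12.8 (pp. 222–223), 13.8 (pp. 227–229), 13.9 (pp. 229–230), 13.14 (p. 234), 14.13 (p. 242), 14.14 and Lemma 14.15 (pp. 243–244), Prop. 14.16 (2) (pp. 244–245)]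
[cite: Kato1999Kodai, Thm. 0.8 (p. 318)]
[cite: SilvermanAEC2009, IV.6.4, VII.2.1, VII.6.1, V.2 (the Euler factor at a good prime), III.8, Thm. X.4.14]
[cite: Tate1975, §1 (the measure c_p·#Ẽ_ns(𝔽_p)/p)]
[cite: BrunsHerzog1998, Thm. 1.3.3, Prop. 1.4.1]
[cite: NeukirchSchmidtWingberg2008, (1.6.7), (1.5.6)–(1.5.7)]
[cite: Rubin2000, Ch. I §3 and Thm. I.7.3; Ch. III §5]
[cite: Lim2017FineSelmer, §3] [cite: CoatesSujatha2005, statement (A) (introduction and §3)]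
[cite: BlochKato1990, §3 Def. 3.10, Ex. 3.11, Prop. 3.8]
[cite: GreenbergLNM1716, Prop. 4.13] -/
def rankZero_padicValNat_sha_add_padicValNat_tamagawa_le_at_two_of_good_of_irreducible_of_fineSelmerDual_fg :
    Prop :=
  ∀ (W : WeierstrassCurve ℚ) [W.IsElliptic] [W.IsGloballyMinimal], ¬ W.HasCM →
    W.HasGoodReductionAtPrime 2 →
    W.HasIrreducibleModPGaloisRep 2 →
    (∀ (κ : ZpExtension ℚ 2), κ.IsCyclotomic →
      ∃ (γ : Field.absoluteGaloisGroup ℚ) (D : W.FineSelmerDualData κ γ),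
        Module.Finite ℤ_[2] (RestrictScalars ℤ_[2] (IwasawaAlgebra 2) D.X)) →
    W.entireLFunction 1 ≠ 0 → Finite W.sha →
    ∃ q : ℚ, W.entireLFunction 1 / (W.realPeriodRat : ℂ) = (q : ℂ) ∧
      (padicValNat 2 (Nat.card (AddCommGroup.primaryComponent W.sha 2)) : ℤ) +
          padicValNat 2 W.tamagawaProduct ≤ padicValRat 2 q

end Literature.NumberTheory.EllipticCurves.Kato2004

end
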